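import Mathlib.AlgebraicGeometry.Morphisms.Smooth
import Mathlib.AlgebraicGeometry.Morphisms.Proper
import Mathlib.AlgebraicGeometry.Morphisms.FinitePresentation
import Mathlib.AlgebraicGeometry.Noetherian
import Literature.AlgebraicGeometry.Motives.Varieties
import Literature.AlgebraicGeometry.Motives.VarietiesProperProofs
import Mathlib.AlgebraicGeometry.Geometrically.Connected
import Literature.AlgebraicGeometry.Motives.FamiliesVHS
import Literature.AlgebraicGeometry.Motives.GoodReductionSpecialFibreProofs
import Literature.AlgebraicGeometry.Morphisms.GenericFibreSmooth
import HarnessLib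

/-!
# Curve nets: a smooth projective variety fibred in curves over `ℙᵐ`

Topic `Literature/AlgebraicGeometry/Motives`. Let `X` be a smooth projective variety of dimension
`n = m + 1 ≥ 1` over a field `k`, embedded in some `ℙᴺ_k`, and let `Λ ⊂ ℙᴺ` be a linear subspace
of codimension `n` meeting `X` transversally in finitely many reduced points `F = X ∩ Λ`. The
linear projection from `Λ` is a rational map `X ⇢ ℙᵐ`, `m = n - 1`, whose indeterminacy is
resolved by blowing up its base locus `F` (Hartshorne, *Algebraic Geometry*, II Example 7.17.3:
"eliminate the points of indeterminacy of a rational map determined by an invertible sheaf" by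
blowing up the base ideal of the sections `s₀, …, sₘ`); one obtains

* the blow-down `σ : X̃ = Bl_F X → X`, an isomorphism over `X ∖ F`, with `X̃` again smooth,
  projective and geometrically irreducible of dimension `n` (`F` is a finite reduced set of points);
* the morphism `π : X̃ → ℙᵐ` extending the projection; its fibre over `b ∈ ℙᵐ` is the CURVE section
  `C_b = X ∩ ⟨Λ, b⟩` of `X` by the codimension-`(n-1)` linear space spanned by `Λ` and `b`:
  non-empty (projective dimension theorem, Hartshorne I Thm. 7.2), of pure dimension one (a
  surface `S ⊆ C_b` would meet the hyperplane `Λ` of `⟨Λ, b⟩` in a curve inside the finite `F`),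
  and GEOMETRICALLY CONNECTED — over `k̄`, `X ∖ C_b = X ∖ ⟨Λ, b⟩` is covered by the `m` affine
  complements of hyperplanes cutting out `⟨Λ, b⟩`, so `cd(X ∖ C_b) ≤ m - 1 = dim X - 2` and `C_b`
  is connected by Hartshorne, *Ample Subvarieties of Algebraic Varieties*, III Cor. 3.9 (equally:
  the Fulton–Hansen connectedness theorem, Ann. of Math. 110 (1979), for `dim X + dim ⟨Λ,b⟩ > N`);
  connectedness of all closed geometric fibres of the proper `π` then gives geometric
  connectedness of every fibre (Stein factorisation, Hartshorne III Cor. 11.3 / 11.5);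
* the DISCRIMINANT `Δ ⊂ ℙᵐ`, the closed set of `b` with `C_b` singular, and its complement
  `U = ℙᵐ ∖ Δ`, the largest open subset of the base over which `π` is smooth; over `U`, `π` is a
  smooth projective family of (geometrically irreducible: smooth + geometrically connected) curves
  and `R¹π_*` restricted to `U` is the local system of `H¹` of the curves `C_b` (their Jacobians).

For `n = 2` (so `m = 1`) this is a pencil and `X̃ = {(x, t) ∈ X × ℙ¹ | x ∈ X_t}` is the incidence
variety of Voisin, *Hodge Theory and Complex Algebraic Geometry II*, §2.3.1 ("Blowup of the base
locus": `τ : X̃ → X` is the blow-up of `X` along the base locus, `f = pr₂ : X̃ → ℙ¹` has fibres the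
members `X_t`), with the discriminant of §2.1.1 (the set of singular members). For general `n` the
same incidence variety `{(x, b) ∈ X × ℙᵐ | x ∈ ⟨Λ, b⟩}` describes `Bl_F X`; replacing `𝒪_X(1)` by
`𝒪_X(d)` (the `d`-uple embedding) gives the *degree-`d` curve nets*, with `#F = dⁿ · deg X`. This is
the "fibred variety" setting of Arapura, *Hodge cycles and the Leray filtration* (2022), §1: "a
surjective morphism with connected fibres between smooth projective varieties" `f : X → Y` with
`dim Y < dim X`, "`U ⊆ Y` the complement of the discriminant and `V = f⁻¹U`", `f` smooth over `U`.

## What this file records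

`Literature.AlgebraicGeometry.Motives.CurveNet m X` is the STRUCTURE of such a net of curves on `X`
over `ℙᵐ_k`, in the unbundled style of `Literature.AlgebraicGeometry.Motives.IsSmoothProjective` /
`Literature.AlgebraicGeometry.Motives.IsSmoothProjectiveFamily`: the total space `total = X̃` with
`IsSmoothProjective (m + 1) total`, the blow-down `blowDown : total ⟶ X`, its centre
`baseLocus ⊆ X` (closed and `≠ X`) off which `blowDown` restricts to an isomorphism
(`isIso_blowDown_restrict`, stated with Mathlib's `morphismRestrict` `f ∣_ U`), and the projection
`proj : total ⟶ Literature.AlgebraicGeometry.Motives.projectiveSpace m k` with GEOMETRICALLY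
CONNECTED fibres (`geometricallyConnected_proj`, Mathlib `AlgebraicGeometry.GeometricallyConnected`)
and of RELATIVE DIMENSION ONE wherever it is smooth (`smoothOfRelativeDimension_one`). These are
exactly the data and properties delivered by the generic-projection construction above and consumed
by curve-fibration ("Weil II"-style) arguments; the existence statement "every smooth projective
`X` of dimension `m + 1 ≥ 2` carries a curve net (after blowing up)" is a theorem about this
structure (Bertini + Hartshorne II 7.17.3 + the connectedness theorem), not a field, and is NOT
asserted here.

From these data the file DEFINES and proves:

* `CurveNet.surjective_proj` (geometrically connected fibres are non-empty), `CurveNet.isProper_proj`,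
  `CurveNet.locallyOfFinitePresentation_proj` (so that Mathlib's smooth locus
  `Scheme.Hom.smoothLocus` of `proj` is available), `CurveNet.surjective_blowDown`;
* `CurveNet.discriminant N : Set ℙᵐ` — the image under `proj` of the non-smooth locus of `proj`,
  i.e. the set of `b` whose fibre `C_b` is singular somewhere — and `CurveNet.isClosed_discriminant`
  (`proj` is proper, hence closed);
* `CurveNet.smoothBase N : ℙᵐ.Opens`, the complement `U = ℙᵐ ∖ Δ`, with
  `CurveNet.smooth_proj_restrict : Smooth (proj ∣_ U)`, the maximality
  `CurveNet.le_smoothBase_of_smooth` (any open over which `proj` is smooth lies in `U`) and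
  `CurveNet.discriminant_eq_empty_iff : Δ = ∅ ↔ Smooth proj`;
* the smooth part of the net as a morphism of `k`-schemes
  `CurveNet.smoothFamily N : N.smoothTotal ⟶ N.smoothBaseOver` (`π⁻¹(U) → U`) and the theorem
  `CurveNet.isSmoothProjectiveFamily_smoothFamily : IsSmoothProjectiveFamily N.smoothFamily 1` —
  smooth of relative dimension one, proper, every rational fibre a smooth projective geometrically
  irreducible curve (smooth + geometrically connected ⇒ geometrically irreducible,
  `Literature.AlgebraicGeometry.Motives.geometricallyIrreducible_of_geometricallyConnected_of_smoothOfRelativeDimension`)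
  — the input of `Literature.AlgebraicGeometry.Motives.IsSmoothProjectiveFamily` and, over `ℂ`,
  of `Literature.AlgebraicGeometry.Motives.GeometricVHSData · N.smoothFamily 1 1` (weight one:
  `R¹π_*ℚ|_U`);
* the fibre curves `CurveNet.fiber N b` over rational points of `ℙᵐ` (via
  `Literature.AlgebraicGeometry.Motives.fiberOver`): all geometrically connected and proper
  (`geometricallyConnected_fiber_hom`, `connectedSpace_fiber`, `isProper_fiber_hom`), and smooth
  projective geometrically irreducible curves over the rational points of the smooth base
  (`isSmoothProjective_fiber_comp`, through the identification `fiberOverSmoothFamilyIso` of the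
  fibres of `smoothFamily` with fibre curves of the net, and `IsSmoothProjective.of_iso`);
* the tautological constructor `CurveNet.ofFibration`: a smooth projective `X` of dimension
  `m + 1` with a `k`-morphism `X → ℙᵐ` with geometrically connected fibres, of relative dimension
  one where smooth, is a curve net on itself (`σ = 𝟙`, `F = ∅`).

## What is deliberately NOT recorded

* The linear-algebra genesis of `proj` (the embedding `X ↪ ℙᴺ`, the centre `Λ`, the identification
  of `total` with `Bl_F X` and of `proj ∘ σ⁻¹` with the linear projection on `X ∖ F`) and the degree
  `d` of the net: no consumer needs them, and Mathlib has no global blow-ups; the fibrewise content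
  (geometric connectedness, relative dimension one, dimension `m + 1` over `ℙᵐ`, birationality of
  `σ`) is what is kept.
* Flatness of `proj` / pure one-dimensionality of the SINGULAR fibres: true for the generic
  projection (see above; then `π` is flat by miracle flatness), automatic over `smoothBase`
  (smooth ⇒ flat), and not used by consumers; assume `[Flat N.proj.left]` where wanted.
* Non-emptiness of `smoothBase` (`Δ ≠ ℙᵐ`): in characteristic `0` this is generic smoothness
  (Hartshorne III Cor. 10.7); in characteristic `p` it can fail (quasi-elliptic fibrations), so it
  is not a field.

## Mathlib / tree search

Mathlib has `Proj`, blow-up algebras only affine-locally (tree: `Literature.AlgebraicGeometry.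
Resolution.affineBlowup`), `Scheme.Hom.smoothLocus`, `morphismRestrict`, `GeometricallyConnected`
/ `GeometricallyIrreducible` with base change; no linear projections, no Lefschetz pencils, no
discriminant of a morphism (searched `discriminantLocus`, `LefschetzPencil`, `CurveNet`,
`linearProjection`: no hits). The tree has `projectiveSpace`, `IsSmoothProjective`, `fiberOver`,
`IsSmoothProjectiveFamily` (`Motives/Varieties`, `Motives/FamiliesVHS`), the smooth-locus calculus
`Literature.AlgebraicGeometry.Morphisms.smooth_morphismRestrict_of_preimage_le_smoothLocus`
(`Morphisms/GenericFibreSmooth`) and "smooth + geometrically connected ⇒ geometrically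
irreducible" (`Motives/GoodReductionSpecialFibreProofs`), all reused here.

## References

* R. Hartshorne, *Algebraic Geometry*, GTM 52 (1977): I Thm. 7.2 (projective dimension theorem),
  II Example 7.17.3 (blowing up the base locus of `s₀, …, sₙ` extends `U → ℙⁿ_A` to `X̃ → ℙⁿ_A`),
  II Thm. 8.18 (Bertini), III Cor. 10.7 (generic smoothness), III Cor. 11.3 and 11.5 (Zariski
  connectedness, Stein factorisation). [Hartshorne1977]
* R. Hartshorne, *Ample Subvarieties of Algebraic Varieties*, LNM 156 (1970): III Cor. 3.9
  (`X` complete non-singular of dimension `n`, `cd(X ∖ Y) ≤ n - 2 ⇒ Y` connected). [Hartshorne1970]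
* W. Fulton, J. Hansen, *A connectedness theorem for projective varieties, with applications to
  intersections and singularities of mappings*, Ann. of Math. 110 (1979), 159–166 (not held;
  cited for orientation only). [FultonHansen1979]
* C. Voisin, *Hodge Theory and Complex Algebraic Geometry II*, CUP (2003): §2.1.1 (pencils, base
  locus, discriminant variety `𝒟_X`), §2.3.1 (blow-up of the base locus, `f : X̃ → ℙ¹`). [VoisinHodgeII2003]
* D. Arapura, *Hodge cycles and the Leray filtration*, Pacific J. Math. 319 (2022), §1
  (fibred varieties with connected fibres, `U` = complement of the discriminant, `V = f⁻¹U`).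
  [Arapura2022]
-/

universe u

open CategoryTheory AlgebraicGeometry Limits TopologicalSpace

noncomputable section

namespace Literature.AlgebraicGeometry.Motives

variable {k : Type u} [Field k]

/-- A **curve net** on a `k`-scheme `X` over `ℙᵐ_k` (a net of curve sections; for `m = 1` a
pencil): the data produced by projecting a smooth projective `(m+1)`-fold `X ⊂ ℙᴺ` from a general
linear centre `Λ` of codimension `m + 1` and blowing up the finite base locus `F = X ∩ Λ`
(Hartshorne II Example 7.17.3; Voisin II §2.3.1 for pencils; Arapura 2022 §1 "a surjective
morphism with connected fibres between smooth projective varieties"), namely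

* `total` — the total space `X̃` (`= Bl_F X`), smooth projective geometrically irreducible of
  dimension `m + 1` (`isSmoothProjective_total`);
* `blowDown : total ⟶ X` — the blow-down `σ`, an isomorphism over the complement of the closed
  centre `baseLocus ⊊ X` (`isIso_blowDown_restrict`, with Mathlib's `f ∣_ U`);
* `proj : total ⟶ ℙᵐ_k` — the net map `π`, with GEOMETRICALLY CONNECTED fibres
  (`geometricallyConnected_proj`, Mathlib `GeometricallyConnected`; for the generic projection every
  fibre is the linear section `C_b = X ∩ ⟨Λ, b⟩` of the smooth irreducible `X` by a linear space of
  codimension `m < dim X`, which is non-empty and connected over `k̄`: Hartshorne, *Ample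
  Subvarieties*, III Cor. 3.9 with `cd(X ∖ C_b) ≤ m - 1`, or Fulton–Hansen) — in particular `π` is
  surjective (`CurveNet.surjective_proj`) — and of RELATIVE DIMENSION ONE wherever it is smooth
  (`smoothOfRelativeDimension_one`: the fibres are curves).

The discriminant, the smooth base `U = ℙᵐ ∖ Δ`, the smooth family `π⁻¹(U) → U` and the fact that
it is a smooth projective family of geometrically irreducible curves
(`CurveNet.isSmoothProjectiveFamily_smoothFamily`) are DEFINED / PROVED from these data below.
Not recorded: the embedding/centre/degree and flatness of `π` (see the module docstring).
[cite: Hartshorne1977, II Example 7.17.3 and I Thm. 7.2] [cite: VoisinHodgeII2003, §2.3.1] -/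
structure CurveNet (m : ℕ) (X : SchemeOver k) where
  /-- The total space `X̃` of the net (the blow-up of `X` along the base locus). -/
  total : SchemeOver k
  /-- `X̃` is a smooth projective geometrically irreducible variety of dimension `m + 1`. -/
  isSmoothProjective_total : IsSmoothProjective (m + 1) total
  /-- The blow-down `σ : X̃ ⟶ X` over `k`. -/
  blowDown : total ⟶ X
  /-- The centre `F ⊆ X` of the blow-down (the base locus of the net). -/
  baseLocus : Set X.left
  /-- The base locus is Zariski closed. -/
  isClosed_baseLocus : IsClosed baseLocus
  /-- The base locus is not all of `X` (so `σ` is birational). -/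
  baseLocus_ne_univ : baseLocus ≠ Set.univ
  /-- `σ` restricts to an isomorphism `σ⁻¹(X ∖ F) ⟶ X ∖ F`. -/
  isIso_blowDown_restrict :
    IsIso (blowDown.left ∣_ (⟨baseLocusᶜ, isClosed_baseLocus.isOpen_compl⟩ : X.left.Opens))
  /-- The net map `π : X̃ ⟶ ℙᵐ_k` over `k`. -/
  proj : total ⟶ projectiveSpace m k
  /-- `π` has geometrically connected (in particular non-empty) fibres: every base change of `π`
  to a field is a connected scheme (Mathlib `GeometricallyConnected`). -/
  geometricallyConnected_proj : GeometricallyConnected proj.left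
  /-- Wherever `π` is smooth it is smooth of relative dimension one (the fibres are curves): for
  every open `U ⊆ ℙᵐ` with `π ∣_ U` smooth, `π ∣_ U` is `SmoothOfRelativeDimension 1`. -/
  smoothOfRelativeDimension_one : ∀ U : (projectiveSpace m k).left.Opens,
    Smooth (proj.left ∣_ U) → SmoothOfRelativeDimension 1 (proj.left ∣_ U)

namespace CurveNet

variable {m : ℕ} {X : SchemeOver k} (N : CurveNet m X)

/-! ### The blow-down -/

/-- The open complement `X ∖ F` of the base locus. [folklore] -/
def offBaseLocus : X.left.Opens :=
  ⟨N.baseLocusᶜ, N.isClosed_baseLocus.isOpen_compl⟩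

/-- Membership in `X ∖ F`. [folklore] -/
@[simp]
theorem mem_offBaseLocus {x : X.left} : x ∈ N.offBaseLocus ↔ x ∉ N.baseLocus := Iff.rfl

/-- `X ∖ F` is non-empty (`F ≠ X`). [folklore] -/
theorem offBaseLocus_nonempty : (N.offBaseLocus : Set X.left).Nonempty :=
  Set.nonempty_compl.mpr N.baseLocus_ne_univ

/-- `σ⁻¹(X ∖ F) ⟶ X ∖ F` is an isomorphism (field `isIso_blowDown_restrict`). [folklore] -/
instance isIso_blowDown_morphismRestrict : IsIso (N.blowDown.left ∣_ N.offBaseLocus) :=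
  N.isIso_blowDown_restrict

/-- The structure morphism of the total space `X̃ → Spec k` is smooth. [folklore] -/
theorem smooth_total_hom : Smooth N.total.hom :=
  haveI := N.isSmoothProjective_total.smoothOfRelativeDimension
  SmoothOfRelativeDimension.smooth (m + 1) N.total.hom

/-- The total space `X̃` is proper over `k` (projective ⇒ proper, Hartshorne II Thm. 4.9).
[cite: Hartshorne1977, II Thm. 4.9] -/
theorem isProper_total_hom : IsProper N.total.hom :=
  N.isSmoothProjective_total.isProjectiveOver.isProper

/-- The total space `X̃` is irreducible (geometrically irreducible over the point `Spec k`).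
[folklore] -/
theorem irreducibleSpace_total : IrreducibleSpace N.total.left :=
  haveI := N.isSmoothProjective_total.geometricallyIrreducible
  GeometricallyIrreducible.irreducibleSpace_of_subsingleton N.total.hom

/-- Over a separated `X` (e.g. `X` projective) the blow-down `σ` is proper: `σ ≫ (X → Spec k)`
is the proper structure map of `X̃` (Hartshorne II Cor. 4.8(e)). [cite: Hartshorne1977, II Cor. 4.8(e)] -/
theorem isProper_blowDown [IsSeparated X.hom] : IsProper N.blowDown.left := by
  haveI : IsProper (N.blowDown.left ≫ X.hom) := by
    rw [Over.w N.blowDown]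
    exact N.isProper_total_hom
  exact IsProper.of_comp N.blowDown.left X.hom

/-- Every point of `X ∖ F` is in the image of `σ` (`σ` is an isomorphism over `X ∖ F`). [folklore] -/
theorem compl_baseLocus_subset_range_blowDown :
    N.baseLocusᶜ ⊆ Set.range N.blowDown.left.base := by
  intro x hx
  haveI : IsIso (N.blowDown.left ∣_ N.offBaseLocus) := N.isIso_blowDown_restrict
  obtain ⟨y, hy⟩ := (N.blowDown.left ∣_ N.offBaseLocus).surjective ⟨x, hx⟩
  refine ⟨y.1, ?_⟩
  have := congrArg Subtype.val hy
  rwa [morphismRestrict_base_coe] at this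

/-- Over an irreducible separated `X` (e.g. `X` smooth projective) the blow-down `σ : X̃ → X` is
surjective: its image is closed (`σ` proper) and contains the dense open `X ∖ F`. [folklore] -/
theorem surjective_blowDown [IsSeparated X.hom] [IrreducibleSpace X.left] :
    Function.Surjective N.blowDown.left.base := by
  haveI := N.isProper_blowDown
  have hcl : IsClosed (Set.range N.blowDown.left.base) :=
    N.blowDown.left.isClosedMap.isClosed_range
  have hdense : Dense (N.baseLocusᶜ : Set X.left) :=
    N.isClosed_baseLocus.isOpen_compl.dense N.offBaseLocus_nonempty
  rw [← Set.range_eq_univ, ← hcl.closure_eq]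
  exact Set.eq_univ_of_univ_subset
    ((hdense.closure_eq).symm.le.trans (closure_mono N.compl_baseLocus_subset_range_blowDown))

/-! ### The projection to `ℙᵐ` -/

/-- `π` has geometrically connected fibres (field `geometricallyConnected_proj`). [folklore] -/
instance geometricallyConnected : GeometricallyConnected N.proj.left :=
  N.geometricallyConnected_proj

/-- `π : X̃ → ℙᵐ` is surjective on points: a morphism with geometrically connected fibres has
non-empty fibres (for the generic projection: every linear section `X ∩ ⟨Λ, b⟩` is non-empty by
the projective dimension theorem, Hartshorne I Thm. 7.2). [cite: Hartshorne1977, I Thm. 7.2] -/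
theorem surjective_proj : Function.Surjective N.proj.left.base :=
  N.proj.left.surjective


/-- The net map `π : X̃ → ℙᵐ` is proper: `π ≫ (ℙᵐ → Spec k)` is the proper structure map of `X̃`
and `ℙᵐ → Spec k` is separated (Hartshorne II Cor. 4.8(e)). [cite: Hartshorne1977, II Cor. 4.8(e)] -/
theorem isProper_proj : IsProper N.proj.left := by
  haveI : IsProper (projectiveSpace m k).hom := isProper_projectiveSpace m k
  haveI : IsProper (N.proj.left ≫ (projectiveSpace m k).hom) := by
    rw [Over.w N.proj]
    exact N.isProper_total_hom
  exact IsProper.of_comp N.proj.left (projectiveSpace m k).hom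

/-- `π` is locally of finite type: `π ≫ (ℙᵐ → Spec k) = (X̃ → Spec k)` is smooth, hence locally
of finite type, and the first factor of a composite locally of finite type is locally of finite
type (Mathlib `locallyOfFiniteType_of_comp`). [folklore] -/
theorem locallyOfFiniteType_proj : LocallyOfFiniteType N.proj.left := by
  haveI : LocallyOfFiniteType (N.proj.left ≫ (projectiveSpace m k).hom) := by
    rw [Over.w N.proj]
    haveI := N.smooth_total_hom
    infer_instance
  exact locallyOfFiniteType_of_comp N.proj.left (projectiveSpace m k).hom

/-- `π` is locally of finite presentation (locally of finite type over the locally Noetherian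
`ℙᵐ_k`), so that Mathlib's smooth locus `N.proj.left.smoothLocus` is available. [folklore] -/
instance locallyOfFinitePresentation_proj : LocallyOfFinitePresentation N.proj.left := by
  haveI := N.locallyOfFiniteType_proj
  haveI : IsProper (projectiveSpace m k).hom := isProper_projectiveSpace m k
  haveI : IsLocallyNoetherian (projectiveSpace m k).left :=
    LocallyOfFiniteType.isLocallyNoetherian (projectiveSpace m k).hom
  infer_instance

/-- The base `ℙᵐ` is non-empty (it is the image of the non-empty `X̃`). [folklore] -/
theorem nonempty_base (N : CurveNet m X) : Nonempty (projectiveSpace m k).left :=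
  haveI := N.irreducibleSpace_total
  ⟨N.proj.left.base (Classical.arbitrary N.total.left)⟩

/-! ### The discriminant and the smooth base -/

/-- The **discriminant** `Δ ⊆ ℙᵐ` of the net: the image under `π` of the non-smooth locus of `π`,
i.e. the set of `b ∈ ℙᵐ` such that the fibre curve `C_b` is singular (not smooth over `κ(b)`) at
some point (Voisin II §2.1.1 "the set of singular hyperplane sections"; Arapura 2022 §1).
[cite: VoisinHodgeII2003, §2.1.1] -/
def discriminant : Set (projectiveSpace m k).left :=
  N.proj.left.base '' (N.proj.left.smoothLocus : Set N.total.left)ᶜ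

/-- `b ∈ Δ` iff some point of `X̃` over `b` is not in the smooth locus of `π`. [folklore] -/
theorem mem_discriminant_iff {b : (projectiveSpace m k).left} :
    b ∈ N.discriminant ↔ ∃ x : N.total.left, x ∉ N.proj.left.smoothLocus ∧ N.proj.left.base x = b :=
  Iff.rfl

/-- The discriminant is closed (`π` is proper, hence a closed map, and the smooth locus is open).
[folklore] -/
theorem isClosed_discriminant : IsClosed N.discriminant :=
  haveI := N.isProper_proj
  N.proj.left.isClosedMap _ N.proj.left.smoothLocus.isOpen.isClosed_compl

/-- The **smooth base** `U = ℙᵐ ∖ Δ` of the net: the open set of `b` all of whose fibre points are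
smooth points of `π` (Arapura 2022 §1: "`U ⊆ Y` the complement of the discriminant").
[cite: Arapura2022, §1] -/
def smoothBase : (projectiveSpace m k).left.Opens :=
  ⟨N.discriminantᶜ, N.isClosed_discriminant.isOpen_compl⟩

/-- Membership in the smooth base: every point over `b` is a smooth point of `π`. [folklore] -/
theorem mem_smoothBase_iff {b : (projectiveSpace m k).left} :
    b ∈ N.smoothBase ↔ ∀ x : N.total.left, N.proj.left.base x = b → x ∈ N.proj.left.smoothLocus := by
  change b ∉ N.discriminant ↔ _
  simp only [mem_discriminant_iff, not_exists, not_and]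
  exact forall_congr' fun x => ⟨fun h hx => not_not.mp fun hn => h hn hx, fun h hn hx => hn (h hx)⟩

/-- The smooth base is the complement of the discriminant. [folklore] -/
@[simp]
theorem coe_smoothBase : (N.smoothBase : Set (projectiveSpace m k).left) = N.discriminantᶜ := rfl

/-- `π⁻¹(U)` lies in the smooth locus of `π`. [folklore] -/
theorem preimage_smoothBase_le_smoothLocus :
    N.proj.left ⁻¹ᵁ N.smoothBase ≤ N.proj.left.smoothLocus := by
  intro x hx
  exact (N.mem_smoothBase_iff.mp hx) x rfl

/-- **`π` is smooth over the smooth base**: `π⁻¹(U) → U` is a smooth morphism. [folklore] -/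
theorem smooth_proj_restrict : Smooth (N.proj.left ∣_ N.smoothBase) :=
  Literature.AlgebraicGeometry.Morphisms.smooth_morphismRestrict_of_preimage_le_smoothLocus
    N.proj.left N.smoothBase N.preimage_smoothBase_le_smoothLocus

/-- **Maximality of the smooth base**: if `π` is smooth over an open `V ⊆ ℙᵐ` then `V ⊆ U`.
[folklore] -/
theorem le_smoothBase_of_smooth (V : (projectiveSpace m k).left.Opens)
    (hV : Smooth (N.proj.left ∣_ V)) : V ≤ N.smoothBase := by
  intro b hb
  refine N.mem_smoothBase_iff.mpr fun x hx => ?_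
  have hxV : x ∈ N.proj.left ⁻¹ᵁ V := by
    change N.proj.left.base x ∈ V
    rwa [hx]
  have hmem : (⟨x, hxV⟩ : (N.proj.left ⁻¹ᵁ V : N.total.left.Opens)) ∈ (N.proj.left ∣_ V).smoothLocus := by
    rw [Scheme.Hom.smoothLocus_eq_top]
    trivial
  exact (Literature.AlgebraicGeometry.Morphisms.mem_smoothLocus_morphismRestrict_iff
    N.proj.left V ⟨x, hxV⟩).mp hmem

/-- The discriminant is empty iff `π` is smooth everywhere. [folklore] -/
theorem discriminant_eq_empty_iff : N.discriminant = ∅ ↔ Smooth N.proj.left := by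
  rw [discriminant, Set.image_eq_empty, Set.compl_empty_iff, ← Scheme.Hom.smoothLocus_eq_top_iff,
    ← Opens.coe_eq_univ]

/-- The smooth base is everything iff `π` is smooth everywhere. [folklore] -/
theorem smoothBase_eq_top_iff : N.smoothBase = ⊤ ↔ Smooth N.proj.left := by
  rw [← N.discriminant_eq_empty_iff, ← Opens.coe_eq_univ, coe_smoothBase, Set.compl_univ_iff]

/-! ### The smooth family of curves `π⁻¹(U) → U` and the fibres -/

/-- The smooth base `U ⊆ ℙᵐ` as a `k`-scheme (open subscheme of `ℙᵐ_k`). [folklore] -/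
def smoothBaseOver : SchemeOver k :=
  Over.mk (N.smoothBase.ι ≫ (projectiveSpace m k).hom)

/-- The smooth part `π⁻¹(U) ⊆ X̃` of the net as a `k`-scheme. [folklore] -/
def smoothTotal : SchemeOver k :=
  Over.mk ((N.proj.left ⁻¹ᵁ N.smoothBase).ι ≫ N.total.hom)

/-- The **smooth family of curves** of the net: the restriction `π⁻¹(U) ⟶ U` of `π` over the smooth
base, as a morphism of `k`-schemes (the "smooth projective family `V = f⁻¹U → U`" of Arapura
2022 §1; over `ℂ`, `R¹` of this family is the weight-one variation of Hodge structure of the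
Jacobians of the curves `C_b`). [cite: Arapura2022, §1] -/
def smoothFamily : N.smoothTotal ⟶ N.smoothBaseOver :=
  Over.homMk (N.proj.left ∣_ N.smoothBase) (by
    change (N.proj.left ∣_ N.smoothBase) ≫ N.smoothBase.ι ≫ (projectiveSpace m k).hom =
      (N.proj.left ⁻¹ᵁ N.smoothBase).ι ≫ N.total.hom
    rw [← Category.assoc, morphismRestrict_ι, Category.assoc, Over.w N.proj])

/-- The underlying scheme morphism of the smooth family is `π ∣_ U`. [folklore] -/
@[simp]
theorem smoothFamily_left : N.smoothFamily.left = N.proj.left ∣_ N.smoothBase := rfl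

/-- The smooth family `π⁻¹(U) → U` is smooth. [folklore] -/
theorem smooth_smoothFamily_left : Smooth N.smoothFamily.left := by
  rw [smoothFamily_left]
  exact N.smooth_proj_restrict

/-- The smooth family `π⁻¹(U) → U` is proper (base change of the proper `π`). [folklore] -/
theorem isProper_smoothFamily_left : IsProper N.smoothFamily.left := by
  haveI : IsProper N.proj.left := N.isProper_proj
  show IsProper (N.proj.left ∣_ N.smoothBase)
  infer_instance

/-- The smooth family `π⁻¹(U) → U` has geometrically connected fibres (restriction of `π`).
[folklore] -/
instance geometricallyConnected_smoothFamily_left :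
    GeometricallyConnected N.smoothFamily.left := by
  show GeometricallyConnected (N.proj.left ∣_ N.smoothBase)
  infer_instance

/-- The smooth family `π⁻¹(U) → U` is smooth of relative dimension one (field
`smoothOfRelativeDimension_one` on the smooth base). [folklore] -/
theorem smoothOfRelativeDimension_smoothFamily_left :
    SmoothOfRelativeDimension 1 N.smoothFamily.left := by
  rw [smoothFamily_left]
  exact N.smoothOfRelativeDimension_one _ N.smooth_proj_restrict

/-- The inclusion `π⁻¹(U) ⟶ X̃` of the smooth part, over `k`. [folklore] -/
def smoothTotalι : N.smoothTotal ⟶ N.total :=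
  Over.homMk (N.proj.left ⁻¹ᵁ N.smoothBase).ι rfl

/-- The inclusion `U ⟶ ℙᵐ` of the smooth base, over `k`. [folklore] -/
def smoothBaseι : N.smoothBaseOver ⟶ projectiveSpace m k :=
  Over.homMk N.smoothBase.ι rfl

/-- The underlying scheme morphism of `smoothTotalι` is the open immersion `π⁻¹(U) ↪ X̃`. [folklore] -/
@[simp]
theorem smoothTotalι_left : N.smoothTotalι.left = (N.proj.left ⁻¹ᵁ N.smoothBase).ι := rfl

/-- The underlying scheme morphism of `smoothBaseι` is the open immersion `U ↪ ℙᵐ`. [folklore] -/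
@[simp]
theorem smoothBaseι_left : N.smoothBaseι.left = N.smoothBase.ι := rfl

/-- The smooth family is the restriction of `π`: `smoothFamily ≫ (U ↪ ℙᵐ) = (π⁻¹(U) ↪ X̃) ≫ π`.
[folklore] -/
theorem smoothFamily_comp_smoothBaseι : N.smoothFamily ≫ N.smoothBaseι = N.smoothTotalι ≫ N.proj := by
  ext : 1
  exact morphismRestrict_ι N.proj.left N.smoothBase

/-! ### The fibres: smooth projective geometrically irreducible curves over the smooth base -/

/-- The structure morphism of `Spec k` as a `k`-scheme is an isomorphism (it is
`Spec (algebraMap k k) = 𝟙`; cf. `Literature.NumberTheory.Transcendental.specOver_self_hom`, not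
imported here to keep `Motives` free of the analytic hierarchy). [folklore] -/
theorem isIso_specOver_self_hom (k : Type u) [Field k] : IsIso (specOver k k).hom := by
  change IsIso (Spec.map (CommRingCat.ofHom (algebraMap k k)))
  rw [Algebra.algebraMap_self, CommRingCat.ofHom_id, Spec.map_id]
  infer_instance

/-- A `k`-rational point of a separated `k`-scheme is a closed immersion `Spec k ⟶ S` (a section
of the separated structure morphism; Hartshorne II Ex. 4.8 / Cor. 4.8-type cancellation).
[folklore] -/
theorem isClosedImmersion_left_of_isSeparated {S : SchemeOver k} [IsSeparated S.hom]
    (b : AlgPoints S k) : IsClosedImmersion b.left := by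
  refine MorphismProperty.of_postcomp (W := @IsClosedImmersion) (W' := @IsSeparated)
    b.left S.hom inferInstance ?_
  rw [Over.w b]
  haveI := isIso_specOver_self_hom k
  infer_instance

/-- `ℙᵐ_k` is separated over `k` (proper). [folklore] -/
theorem isSeparated_projectiveSpace_hom (m : ℕ) (k : Type u) [Field k] :
    IsSeparated (projectiveSpace m k).hom :=
  haveI : IsProper (projectiveSpace m k).hom := isProper_projectiveSpace m k
  inferInstance

/-- The smooth base `U` is separated over `k` (open in `ℙᵐ_k`). [folklore] -/
theorem isSeparated_smoothBaseOver_hom : IsSeparated N.smoothBaseOver.hom := by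
  haveI := isSeparated_projectiveSpace_hom m k
  show IsSeparated (N.smoothBase.ι ≫ (projectiveSpace m k).hom)
  infer_instance

section Fibres

variable (s : AlgPoints N.smoothBaseOver k)

/-- The fibre of the smooth family over a rational point `s ∈ U(k)`, included in `X̃`, is the base
change of `π` along the closed point `Spec k → U ↪ ℙᵐ` (pasting the fibre square with the
restriction square `isPullback_morphismRestrict`). [folklore] -/
theorem isPullback_fiber_smoothFamily :
    IsPullback (pullback.fst N.smoothFamily.left s.left ≫ (N.proj.left ⁻¹ᵁ N.smoothBase).ι)
      (pullback.snd N.smoothFamily.left s.left) N.proj.left (s.left ≫ N.smoothBase.ι) :=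
  (IsPullback.of_hasPullback N.smoothFamily.left s.left).paste_horiz
    (isPullback_morphismRestrict N.proj.left N.smoothBase).flip

/-- The rational point `Spec k → U ↪ ℙᵐ` underlying `s ∈ U(k)` is a closed immersion. [folklore] -/
theorem isClosedImmersion_algPoints_comp_ι : IsClosedImmersion (s.left ≫ N.smoothBase.ι) := by
  have h : IsClosedImmersion (s ≫ N.smoothBaseι).left :=
    haveI := isSeparated_projectiveSpace_hom m k
    isClosedImmersion_left_of_isSeparated (s ≫ N.smoothBaseι)
  simpa only [Over.comp_left, smoothBaseι_left] using h

/-- The fibre `X̃_s ⟶ X̃` of the smooth family over `s ∈ U(k)` is a closed immersion into `X̃`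
(base change of the closed point). [folklore] -/
theorem isClosedImmersion_fiber_smoothFamily_ι :
    IsClosedImmersion
      (pullback.fst N.smoothFamily.left s.left ≫ (N.proj.left ⁻¹ᵁ N.smoothBase).ι) :=
  haveI := N.isClosedImmersion_algPoints_comp_ι s
  MorphismProperty.of_isPullback (P := @IsClosedImmersion)
    (N.isPullback_fiber_smoothFamily s).flip ‹_›

/-- The fibre of the smooth family over `s ∈ U(k)` is smooth of relative dimension one over `k`
(base change of `π ∣_ U`). [folklore] -/
theorem smoothOfRelativeDimension_one_fiber_snd :
    SmoothOfRelativeDimension 1 (pullback.snd N.smoothFamily.left s.left) :=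
  haveI := smoothOfRelativeDimension_isStableUnderBaseChange (n := 1)
  MorphismProperty.pullback_snd (P := @SmoothOfRelativeDimension 1) _ _
    N.smoothOfRelativeDimension_smoothFamily_left

/-- **The rational fibres of the smooth family are smooth projective geometrically irreducible
curves.** For `s ∈ U(k)`: `X̃_s → Spec k` is smooth of relative dimension `1` (base change of
`π ∣_ U`), `X̃_s ↪ X̃ ↪ ℙᴹ` is a closed immersion (projective), and `X̃_s` is geometrically
connected (base change of `π`) and smooth, hence geometrically irreducible
(`Literature.AlgebraicGeometry.Motives.geometricallyIrreducible_of_geometricallyConnected_of_smoothOfRelativeDimension`,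
Stacks 056S + Görtz–Wedhorn I Ex. 3.16). [folklore] -/
theorem isSmoothProjective_fiberOver_smoothFamily :
    IsSmoothProjective 1 (fiberOver N.smoothFamily s) where
  smoothOfRelativeDimension := by
    rw [fiberOver_hom]
    haveI := isIso_specOver_self_hom k
    exact (MorphismProperty.cancel_right_of_respectsIso (@SmoothOfRelativeDimension 1) _ _).mpr
      (N.smoothOfRelativeDimension_one_fiber_snd s)
  isProjectiveOver := by
    obtain ⟨M, ι, hι⟩ := N.isSmoothProjective_total.isProjectiveOver
    refine ⟨M, fiberι N.smoothFamily s ≫ N.smoothTotalι ≫ ι, ?_⟩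
    rw [Over.comp_left, Over.comp_left, ← Category.assoc]
    haveI : IsClosedImmersion ((fiberι N.smoothFamily s).left ≫ N.smoothTotalι.left) :=
      N.isClosedImmersion_fiber_smoothFamily_ι s
    infer_instance
  geometricallyIrreducible := by
    rw [fiberOver_hom]
    haveI := isIso_specOver_self_hom k
    -- the instance arguments are passed explicitly: their implicit target object is
    -- `(specOver k k).left`, definitionally but not reducibly `Spec k`
    have hirr := @geometricallyIrreducible_of_geometricallyConnected_of_smoothOfRelativeDimension
      k _ _ (pullback.snd N.smoothFamily.left s.left) 1
      (N.smoothOfRelativeDimension_one_fiber_snd s)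
      (inferInstanceAs (GeometricallyConnected (pullback.snd N.smoothFamily.left s.left)))
    exact (MorphismProperty.cancel_right_of_respectsIso (@GeometricallyIrreducible) _ _).mpr hirr

end Fibres

/-- **The smooth part of a curve net is a smooth projective family of curves**: `π⁻¹(U) → U` is
smooth of relative dimension `1`, proper, and every rational fibre is a smooth projective
geometrically irreducible curve — the input format of
`Literature.AlgebraicGeometry.Motives.IsSmoothProjectiveFamily` (and hence, over `ℂ` and given
Betti–Hodge data, of `Literature.AlgebraicGeometry.Motives.GeometricVHSData · · 1 1`, the weight-one
variation of Hodge structure `R¹π_*ℚ|_U` of the Jacobians of the curves; Arapura 2022 §1).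
[cite: Arapura2022, §1] -/
theorem isSmoothProjectiveFamily_smoothFamily : IsSmoothProjectiveFamily N.smoothFamily 1 where
  smoothOfRelativeDimension := N.smoothOfRelativeDimension_smoothFamily_left
  isProper := N.isProper_smoothFamily_left
  isSmoothProjective := N.isSmoothProjective_fiberOver_smoothFamily

/-! ### The fibre curves over points of `ℙᵐ` -/

/-- The **fibre curve** `C_b = π⁻¹(b)` of the net over a `k`-rational point `b ∈ ℙᵐ(k)`, as a
`k`-scheme (`Literature.AlgebraicGeometry.Motives.fiberOver`; for the generic projection this is
the linear section `X ∩ ⟨Λ, b⟩`). [folklore] -/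
def fiber (b : AlgPoints (projectiveSpace m k) k) : SchemeOver k :=
  fiberOver N.proj b

/-- The underlying scheme of the fibre curve is the scheme-theoretic fibre product
`X̃ ×_{ℙᵐ} Spec k`. [folklore] -/
@[simp]
theorem fiber_left (b : AlgPoints (projectiveSpace m k) k) :
    (N.fiber b).left = pullback N.proj.left b.left := rfl

/-- Every fibre curve `C_b` is geometrically connected over `k` (base change of `π`). [folklore] -/
theorem geometricallyConnected_fiber_hom (b : AlgPoints (projectiveSpace m k) k) :
    GeometricallyConnected (N.fiber b).hom := by
  rw [fiber, fiberOver_hom]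
  haveI := isIso_specOver_self_hom k
  exact (MorphismProperty.cancel_right_of_respectsIso (@GeometricallyConnected) _ _).mpr
    (inferInstanceAs (GeometricallyConnected (pullback.snd N.proj.left b.left)))

/-- Every fibre curve `C_b` is connected. [folklore] -/
theorem connectedSpace_fiber (b : AlgPoints (projectiveSpace m k) k) :
    ConnectedSpace (N.fiber b).left :=
  haveI := N.geometricallyConnected_fiber_hom b
  GeometricallyConnected.connectedSpace_of_subsingleton (N.fiber b).hom

/-- Every fibre curve `C_b` is proper over `k` (base change of the proper `π`). [folklore] -/
theorem isProper_fiber_hom (b : AlgPoints (projectiveSpace m k) k) : IsProper (N.fiber b).hom := by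
  rw [fiber, fiberOver_hom]
  haveI := isIso_specOver_self_hom k
  exact (MorphismProperty.cancel_right_of_respectsIso (@IsProper) _ _).mpr
    (MorphismProperty.pullback_snd (P := @IsProper) _ _ N.isProper_proj)

/-! ### Fibre curves over rational points of the smooth base -/

/-- Smooth projective varieties are stable under isomorphism of `k`-schemes (each of the three
conditions respects isomorphisms). [folklore] -/
theorem _root_.Literature.AlgebraicGeometry.Motives.IsSmoothProjective.of_iso {n : ℕ}
    {Y Z : SchemeOver k} (e : Y ≅ Z) (h : IsSmoothProjective n Y) : IsSmoothProjective n Z where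
  smoothOfRelativeDimension := by
    rw [show Z.hom = e.inv.left ≫ Y.hom from (Over.w e.inv).symm]
    exact (MorphismProperty.cancel_left_of_respectsIso (@SmoothOfRelativeDimension n) _ _).mpr
      h.smoothOfRelativeDimension
  isProjectiveOver := by
    obtain ⟨M, ι, hι⟩ := h.isProjectiveOver
    refine ⟨M, e.inv ≫ ι, ?_⟩
    rw [Over.comp_left]
    infer_instance
  geometricallyIrreducible := by
    rw [show Z.hom = e.inv.left ≫ Y.hom from (Over.w e.inv).symm]
    exact (MorphismProperty.cancel_left_of_respectsIso (@GeometricallyIrreducible) _ _).mpr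
      h.geometricallyIrreducible

section FibrePoints

variable (s : AlgPoints N.smoothBaseOver k)

/-- The fibre of the smooth family over `s ∈ U(k)` **is** the fibre curve `C_b` of the net over the
point `b = s` of `ℙᵐ` (both are the fibre product `X̃ ×_{ℙᵐ} Spec k`, by
`isPullback_fiber_smoothFamily`), as an isomorphism of `k`-schemes. [folklore] -/
def fiberOverSmoothFamilyIso : fiberOver N.smoothFamily s ≅ N.fiber (s ≫ N.smoothBaseι) :=
  Over.isoMk (N.isPullback_fiber_smoothFamily s).isoPullback (by
    show (N.isPullback_fiber_smoothFamily s).isoPullback.hom ≫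
        pullback.fst N.proj.left (s.left ≫ N.smoothBase.ι) ≫ N.total.hom =
      pullback.fst N.smoothFamily.left s.left ≫ (N.proj.left ⁻¹ᵁ N.smoothBase).ι ≫ N.total.hom
    rw [IsPullback.isoPullback_hom_fst_assoc, Category.assoc])

/-- Hence the fibre curve over a rational point of `ℙᵐ` coming from the smooth base is a smooth
projective geometrically irreducible curve. [folklore] -/
theorem isSmoothProjective_fiber_comp : IsSmoothProjective 1 (N.fiber (s ≫ N.smoothBaseι)) :=
  (N.isSmoothProjective_fiberOver_smoothFamily s).of_iso (N.fiberOverSmoothFamilyIso s)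

end FibrePoints

/-! ### The tautological curve net of a fibration in curves `X → ℙᵐ` -/

/-- A smooth projective variety `X` of dimension `m + 1` together with a `k`-morphism
`pr : X → ℙᵐ_k` with geometrically connected fibres, of relative dimension one where smooth, is
a curve net on itself: `X̃ = X`, `σ = 𝟙`, empty base locus. (E.g. a curve net `(X̃, σ, π)` on `X`
is the tautological curve net of `π` on `X̃`.) [folklore] -/
def ofFibration (hX : IsSmoothProjective (m + 1) X) (pr : X ⟶ projectiveSpace m k)
    [GeometricallyConnected pr.left]
    (hpr : ∀ U : (projectiveSpace m k).left.Opens,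
      Smooth (pr.left ∣_ U) → SmoothOfRelativeDimension 1 (pr.left ∣_ U)) : CurveNet m X where
  total := X
  isSmoothProjective_total := hX
  blowDown := 𝟙 X
  baseLocus := ∅
  isClosed_baseLocus := isClosed_empty
  baseLocus_ne_univ := by
    haveI := hX.geometricallyIrreducible
    haveI : IrreducibleSpace X.left :=
      GeometricallyIrreducible.irreducibleSpace_of_subsingleton X.hom
    exact Set.empty_ne_univ
  isIso_blowDown_restrict := by
    rw [Over.id_left]
    infer_instance
  proj := pr
  geometricallyConnected_proj := ‹_›
  smoothOfRelativeDimension_one := hpr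

/-- The tautological curve net has total space `X`. [folklore] -/
@[simp]
theorem ofFibration_total (hX : IsSmoothProjective (m + 1) X) (pr : X ⟶ projectiveSpace m k)
    [GeometricallyConnected pr.left]
    (hpr : ∀ U : (projectiveSpace m k).left.Opens,
      Smooth (pr.left ∣_ U) → SmoothOfRelativeDimension 1 (pr.left ∣_ U)) :
    (ofFibration hX pr hpr).total = X := rfl

/-- The tautological curve net has projection `pr`. [folklore] -/
@[simp]
theorem ofFibration_proj (hX : IsSmoothProjective (m + 1) X) (pr : X ⟶ projectiveSpace m k)
    [GeometricallyConnected pr.left]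
    (hpr : ∀ U : (projectiveSpace m k).left.Opens,
      Smooth (pr.left ∣_ U) → SmoothOfRelativeDimension 1 (pr.left ∣_ U)) :
    (ofFibration hX pr hpr).proj = pr := rfl

/-- The tautological curve net has empty base locus. [folklore] -/
@[simp]
theorem ofFibration_baseLocus (hX : IsSmoothProjective (m + 1) X) (pr : X ⟶ projectiveSpace m k)
    [GeometricallyConnected pr.left]
    (hpr : ∀ U : (projectiveSpace m k).left.Opens,
      Smooth (pr.left ∣_ U) → SmoothOfRelativeDimension 1 (pr.left ∣_ U)) :
    (ofFibration hX pr hpr).baseLocus = ∅ := rfl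

/-- The curve net `(X̃, σ, π)` on `X` induces the tautological curve net of `π` on `X̃`, with the
same discriminant. [folklore] -/
theorem discriminant_ofFibration_proj :
    (ofFibration N.isSmoothProjective_total N.proj N.smoothOfRelativeDimension_one).discriminant =
      N.discriminant := rfl

end CurveNet

end Literature.AlgebraicGeometry.Motives

end
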